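import Literature.NumberTheory.EllipticCurves.BinaryQuarticOrbitWeights
import Literature.NumberTheory.EllipticCurves.BhargavaShankarBadPrimesProofs
import Mathlib.NumberTheory.Padics.RingHoms
import HarnessLib

/-!
# Bhargava–Shankar's local weights `m_p(f)`: finiteness for `Δ(f) ≠ 0`, and `m_p(f) = 1` for
# `p² ∤ Δ(f)` (`p ≥ 5`)

`Proofs` companion (theorems only: no definitions, no named facts) of
`BinaryQuarticOrbitWeights.lean` (the weights `m_p(f) = BinaryQuartic.localWeight f =
Σ_{f' ∈ B_p(f)} #Aut_{ℚ_p}(f')/#Aut_{ℤ_p}(f')` of M. Bhargava, A. Shankar, *Binary quartic forms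
having bounded invariants, and the boundedness of the average rank of elliptic curves*, Ann. of
Math. (2) 181 (2015) 191–242, §3.2 of the published version, and their description as the number of
cosets `PGL₂(ℤ_p)g`, `g ∈ PGL₂(ℚ_p)`, with `g · f ∈ V_{ℤ_p}` — `BinaryQuartic.weight_eq_ncard_cosets`),
using the Cartan decomposition of `GL₂(ℚ_p)` (`exists_cartan_decomposition`,
`BhargavaShankarWeightHalfProofs`) and Prop. 3.18 of the published version
(`BinaryQuartic.good_at_of_not_sq_dvd_disc`, `BhargavaShankarBadPrimesProofs`).

* `BinaryQuartic.cosets_padic_finite` — **for `f ∈ V_{ℤ_p}` with `Δ(f) ≠ 0` the cosets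
  `PGL₂(ℤ_p)g` with `g · f ∈ V_{ℤ_p}` are finitely many** (so `m_p(f)` is a genuine finite sum and
  `m_p(f) = #{these cosets} ≥ 1`, `localWeight_eq_ncard_cosets`, `one_le_localWeight_of_disc_ne_zero`).
  Proof (`exists_rep_of_mem_cosets`): by the Cartan decomposition `g⁻¹ = c k₁ diag(pⁿ,1) k₂`, the
  coset in question is that of `(k₂⁻¹ diag(pⁿ,1)⁻¹)⁻¹`, where `diag(pⁿ,1) · (k₂ · f)` is integral;
  this forces `pⁿ ∣ d`, `p²ⁿ ∣ e` for the integral form `k₂ · f`, hence `p²ⁿ ∣ Δ` and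
  `|Δ(f)|_p ≤ p⁻²ⁿ` — a bound on `n` (`le_floor_of_norm_le`); and for fixed `n` the coset of
  `(k diag(pⁿ,1)⁻¹)⁻¹` depends only on `k mod pⁿ` (`coe_mul_diag_inv_eq_of_congr`: if
  `k ≡ k' (mod pⁿ)` then `diag(pⁿ,1) k⁻¹k' diag(pⁿ,1)⁻¹ ∈ GL₂(ℤ_p)`), whence finitely many
  (`finite_range_coe_mul_diag_inv`).
* `BinaryQuartic.localWeight_eq_one_of_not_sq_dvd_disc` — **for `p ≥ 5` and `p² ∤ Δ(f)`,
  `m_p(f) = 1`**: by Prop. 3.18 every `g ∈ GL₂(ℚ_p)` with `g · f` integral lies in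
  `ℚ_pˣ · GL₂(ℤ_p)`, so the only coset is the trivial one ("`m_p(f) = 1` whenever `f` is not bad at
  `p`", the acceptability of `φ_p = 1/m_p` in the proof of Thm 3.19 of the published version).
* For `f ∈ V_ℤ` with `Δ(f) ≠ 0`: `localWeightAt p f = 1` for every prime `p ≥ 5` not dividing
  `Δ(f)` to the second power, hence for all but finitely many `p`
  (`BinaryQuartic.finite_setOf_localWeightAt_ne_one`), so that `∏_p m_p(f)` is a finite product.

## References

* M. Bhargava, A. Shankar, Ann. of Math. (2) 181 (2015) 191–242, §3.2 (the weights `m_p`),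
  Prop. 3.6 and Prop. 3.18 of the published version (= arXiv:1006.1002v3).
  [cite: BhargavaShankarAnnals2015, §3.2 and Prop. 3.18 (published numbering)]
* The Cartan decomposition `GL₂(ℚ_p) = ⋃ₙ ℚ_pˣ GL₂(ℤ_p) diag(pⁿ,1) GL₂(ℤ_p)`. [folklore]
-/

noncomputable section

open scoped Classical
open Matrix MulAction Literature.GroupTheory.Index

namespace Literature.NumberTheory.EllipticCurves

namespace BinaryQuartic

variable {p : ℕ} [Fact p.Prime]


/-! ## Generalities -/

omit [Fact p.Prime] in
/-- A function that factors through a map to a finite type has finite range. [folklore] -/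
theorem finite_range_of_factorsThrough {α β ρ : Type*} [Finite ρ] (F : α → β) (r : α → ρ)
    (h : ∀ a a', r a = r a' → F a = F a') : (Set.range F).Finite := by
  let s : Set.range r → β := fun c ↦ F c.2.choose
  refine (Set.finite_range s).subset ?_
  rintro _ ⟨a, rfl⟩
  refine ⟨⟨r a, a, rfl⟩, ?_⟩
  exact h _ _ (Exists.choose_spec (⟨a, rfl⟩ : ∃ a', r a' = r a))

/-- `BinaryQuartic.map` along `ℤ_p → ℚ_p` is injective. [folklore] -/
theorem map_coe_injective : Function.Injective (BinaryQuartic.map (PadicInt.Coe.ringHom (p := p))) := by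
  intro f g h
  have := congrArg BinaryQuartic.a h; have hb := congrArg BinaryQuartic.b h
  have hc := congrArg BinaryQuartic.c h; have hd := congrArg BinaryQuartic.d h
  have he := congrArg BinaryQuartic.e h
  simp only [map_a, map_b, map_c, map_d, map_e] at this hb hc hd he
  ext
  · exact Subtype.coe_injective this
  · exact Subtype.coe_injective hb
  · exact Subtype.coe_injective hc
  · exact Subtype.coe_injective hd
  · exact Subtype.coe_injective he

/-- The matrix of `Matrix.GeneralLinearGroup.map PadicInt.Coe.ringHom k` is `k.map PadicInt.Coe.ringHom`. [folklore] -/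
theorem coe_mapGL (k : GL (Fin 2) ℤ_[p]) :
    ((Matrix.GeneralLinearGroup.map PadicInt.Coe.ringHom k : GL (Fin 2) ℚ_[p]) : Matrix (Fin 2) (Fin 2) ℚ_[p]) = (k : Matrix (Fin 2) (Fin 2) ℤ_[p]).map PadicInt.Coe.ringHom := rfl

/-- `Matrix.GeneralLinearGroup.map PadicInt.Coe.ringHom k ∈ ℚ_pˣ · GL₂(ℤ_p)`. [folklore] -/
theorem mapGL_mem (k : GL (Fin 2) ℤ_[p]) : Matrix.GeneralLinearGroup.map PadicInt.Coe.ringHom k ∈ integralUpToScalars (PadicInt.Coe.ringHom (p := p)) :=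
  mem_integralUpToScalars_of_eq_map _ (Matrix.isUnits_det_units k) (coe_mapGL k)

/-- The scalar `c · 1 ∈ GL₂(ℚ_p)` (`c ≠ 0`) lies in `ℚ_pˣ · GL₂(ℤ_p)`. [folklore] -/
theorem scalar_mem {c : ℚ_[p]} (hc : c ≠ 0) :
    Matrix.GeneralLinearGroup.scalar (Fin 2) (Units.mk0 c hc) ∈ integralUpToScalars (PadicInt.Coe.ringHom (p := p)) := by
  refine center_le_integralUpToScalars _ ?_
  rw [Matrix.GeneralLinearGroup.center_eq_range_scalar]
  exact ⟨_, rfl⟩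

/-- The diagonal matrix `diag(pⁿ, 1)` over `ℚ_p` has nonzero determinant `pⁿ`. [folklore] -/
theorem det_diagPow (n : ℕ) : (!![(p : ℚ_[p]) ^ n, 0; 0, 1] : Matrix (Fin 2) (Fin 2) ℚ_[p]).det = (p : ℚ_[p]) ^ n := by
  simp [Matrix.det_fin_two]

/-- `pⁿ ≠ 0` in `ℚ_p`. [folklore] -/
theorem p_pow_ne_zero (n : ℕ) : ((p : ℚ_[p]) ^ n) ≠ 0 :=
  pow_ne_zero _ (Nat.cast_ne_zero.mpr (Fact.out : p.Prime).ne_zero)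

/-- `diag(pⁿ,1)` as an element of `GL₂(ℚ_p)` has the expected matrix. [folklore] -/
theorem coe_diagGL (n : ℕ) :
    ((Matrix.GeneralLinearGroup.mkOfDetNeZero (!![(p : ℚ_[p]) ^ n, 0; 0, 1])
        (by rw [det_diagPow]; exact p_pow_ne_zero n) : GL (Fin 2) ℚ_[p]) : Matrix (Fin 2) (Fin 2) ℚ_[p])
      = !![(p : ℚ_[p]) ^ n, 0; 0, 1] := rfl

/-! ## The coset of `k · diag(pⁿ,1)⁻¹` depends only on `k mod pⁿ` -/

/-- If `k ≡ k' (mod pⁿ)` in `GL₂(ℤ_p)` then `k⁻¹k' = 1 + pⁿ M` with `M` integral. [folklore] -/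
theorem exists_inv_mul_eq_one_add {n : ℕ} {k k' : GL (Fin 2) ℤ_[p]}
    (h : (k : Matrix (Fin 2) (Fin 2) ℤ_[p]).map (PadicInt.toZModPow n) =
      (k' : Matrix (Fin 2) (Fin 2) ℤ_[p]).map (PadicInt.toZModPow n)) :
    ∃ M : Matrix (Fin 2) (Fin 2) ℤ_[p],
      ((k⁻¹ * k' : GL (Fin 2) ℤ_[p]) : Matrix (Fin 2) (Fin 2) ℤ_[p]) = 1 + ((p : ℤ_[p]) ^ n) • M := by
  -- entries of `k' - k` are divisible by `pⁿ`
  have hdiff : ∀ i j, ∃ m : ℤ_[p], (k' : Matrix (Fin 2) (Fin 2) ℤ_[p]) i j - (k : Matrix (Fin 2) (Fin 2) ℤ_[p]) i j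
      = (p : ℤ_[p]) ^ n * m := fun i j ↦ by
    have hij := congrFun (congrFun h i) j
    simp only [Matrix.map_apply] at hij
    have : (k' : Matrix (Fin 2) (Fin 2) ℤ_[p]) i j - (k : Matrix (Fin 2) (Fin 2) ℤ_[p]) i j ∈
        RingHom.ker (PadicInt.toZModPow n : ℤ_[p] →+* ZMod (p ^ n)) := by
      rw [RingHom.mem_ker, map_sub, hij, sub_self]
    rw [PadicInt.ker_toZModPow, Ideal.mem_span_singleton] at this
    exact this
  choose m hm using hdiff
  refine ⟨(k⁻¹ : GL (Fin 2) ℤ_[p]) * (Matrix.of fun i j ↦ m i j), ?_⟩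
  have hk : ((k⁻¹ * k' : GL (Fin 2) ℤ_[p]) : Matrix (Fin 2) (Fin 2) ℤ_[p])
      = 1 + (k⁻¹ : GL (Fin 2) ℤ_[p]) * ((k' : Matrix (Fin 2) (Fin 2) ℤ_[p]) - k) := by
    rw [Matrix.mul_sub, Units.val_mul, Units.inv_mul, add_sub_cancel]
  have hsub : ((k' : Matrix (Fin 2) (Fin 2) ℤ_[p]) - k) = ((p : ℤ_[p]) ^ n) • Matrix.of (fun i j ↦ m i j) := by
    ext i j
    simp [hm i j]
  rw [hk, hsub, Matrix.mul_smul]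

/-- The key integrality: `diag(pⁿ,1) (1 + pⁿM) = (1 + E) diag(pⁿ,1)` with
`E = (pⁿM₀₀, p²ⁿM₀₁; M₁₀, pⁿM₁₁)` integral. [folklore] -/
theorem diag_mul_one_add_eq (n : ℕ) (M : Matrix (Fin 2) (Fin 2) ℤ_[p]) :
    !![(p : ℤ_[p]) ^ n, 0; 0, 1] * (1 + ((p : ℤ_[p]) ^ n) • M) =
      (1 + !![(p : ℤ_[p]) ^ n * M 0 0, (p : ℤ_[p]) ^ n * ((p : ℤ_[p]) ^ n * M 0 1); M 1 0, (p : ℤ_[p]) ^ n * M 1 1])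
        * !![(p : ℤ_[p]) ^ n, 0; 0, 1] := by
  ext i j
  fin_cases i <;> fin_cases j <;>
    simp [Matrix.mul_apply, Fin.sum_univ_two, Matrix.one_apply] <;> ring

/-- **The coset `PGL₂(ℤ_p) · (k diag(pⁿ,1)⁻¹)⁻¹`, i.e. the point `k · diag(pⁿ,1)⁻¹ · ℚ_pˣGL₂(ℤ_p)` of
`GL₂(ℚ_p) ⧸ ℚ_pˣGL₂(ℤ_p)`, depends only on `k mod pⁿ`.** [folklore] -/
theorem coe_mul_diag_inv_eq_of_congr {n : ℕ} {k k' : GL (Fin 2) ℤ_[p]}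
    (h : (k : Matrix (Fin 2) (Fin 2) ℤ_[p]).map (PadicInt.toZModPow n) =
      (k' : Matrix (Fin 2) (Fin 2) ℤ_[p]).map (PadicInt.toZModPow n)) :
    let d : GL (Fin 2) ℚ_[p] := Matrix.GeneralLinearGroup.mkOfDetNeZero (!![(p : ℚ_[p]) ^ n, 0; 0, 1])
        (by rw [det_diagPow]; exact p_pow_ne_zero n)
    ((Matrix.GeneralLinearGroup.map PadicInt.Coe.ringHom k * d⁻¹ : GL (Fin 2) ℚ_[p]) : GL (Fin 2) ℚ_[p] ⧸ integralUpToScalars (PadicInt.Coe.ringHom (p := p))) = ((Matrix.GeneralLinearGroup.map PadicInt.Coe.ringHom k' * d⁻¹ : GL (Fin 2) ℚ_[p]) : GL (Fin 2) ℚ_[p] ⧸ integralUpToScalars (PadicInt.Coe.ringHom (p := p))) := by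
  intro d
  obtain ⟨M, hM⟩ := exists_inv_mul_eq_one_add h
  rw [QuotientGroup.eq]
  -- the element `d (Matrix.GeneralLinearGroup.map PadicInt.Coe.ringHom (k⁻¹ k')) d⁻¹`
  have helt : (Matrix.GeneralLinearGroup.map PadicInt.Coe.ringHom k * d⁻¹)⁻¹ * (Matrix.GeneralLinearGroup.map PadicInt.Coe.ringHom k' * d⁻¹) = d * Matrix.GeneralLinearGroup.map PadicInt.Coe.ringHom (k⁻¹ * k') * d⁻¹ := by
    rw [map_mul, map_inv]; group
  rw [helt]
  set E : Matrix (Fin 2) (Fin 2) ℤ_[p] :=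
    !![(p : ℤ_[p]) ^ n * M 0 0, (p : ℤ_[p]) ^ n * ((p : ℤ_[p]) ^ n * M 0 1); M 1 0, (p : ℤ_[p]) ^ n * M 1 1] with hE
  have hD : (d : Matrix (Fin 2) (Fin 2) ℚ_[p]) = (!![(p : ℤ_[p]) ^ n, 0; 0, 1] : Matrix (Fin 2) (Fin 2) ℤ_[p]).map PadicInt.Coe.ringHom := by
    rw [coe_diagGL]
    ext i j; fin_cases i <;> fin_cases j <;> simp
  have hDunit : IsUnit (d : Matrix (Fin 2) (Fin 2) ℚ_[p]).det :=
    isUnit_iff_ne_zero.mpr (det_coe_ne_zero d)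
  -- its matrix is `(1 + E).map PadicInt.Coe.ringHom`
  have hmat : ((d * Matrix.GeneralLinearGroup.map PadicInt.Coe.ringHom (k⁻¹ * k') * d⁻¹ : GL (Fin 2) ℚ_[p]) : Matrix (Fin 2) (Fin 2) ℚ_[p]) = (1 + E).map PadicInt.Coe.ringHom := by
    have h1 : (d : Matrix (Fin 2) (Fin 2) ℚ_[p]) * ((Matrix.GeneralLinearGroup.map PadicInt.Coe.ringHom (k⁻¹ * k') : GL (Fin 2) ℚ_[p]) : Matrix (Fin 2) (Fin 2) ℚ_[p])
        = (1 + E).map PadicInt.Coe.ringHom * (d : Matrix (Fin 2) (Fin 2) ℚ_[p]) := by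
      rw [coe_mapGL, hM, hD, ← Matrix.map_mul, diag_mul_one_add_eq, Matrix.map_mul]
    rw [Units.val_mul, Units.val_mul, Matrix.coe_units_inv, h1, Matrix.mul_nonsing_inv_cancel_right _ _ hDunit]
  -- and its determinant is that of `k⁻¹k'`, a unit
  have hdet : IsUnit (1 + E).det := by
    have h2 : (PadicInt.Coe.ringHom (p := p)) (1 + E).det = (PadicInt.Coe.ringHom (p := p)) ((k⁻¹ * k' : GL (Fin 2) ℤ_[p]) : Matrix (Fin 2) (Fin 2) ℤ_[p]).det := by
      have := congrArg Matrix.det hmat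
      rw [Units.val_mul, Units.val_mul, Matrix.det_mul, Matrix.det_mul, Matrix.coe_units_inv,
        Matrix.det_nonsing_inv, mul_comm (d : Matrix (Fin 2) (Fin 2) ℚ_[p]).det, mul_assoc,
        Ring.mul_inverse_cancel _ hDunit, mul_one, coe_mapGL, ← RingHom.mapMatrix_apply, ← RingHom.map_det,
        ← RingHom.mapMatrix_apply, ← RingHom.map_det] at this
      exact this.symm
    have hinj : Function.Injective ((PadicInt.Coe.ringHom (p := p)) : ℤ_[p] → ℚ_[p]) := fun x y hxy ↦ Subtype.coe_injective hxy
    rw [hinj h2]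
    exact Matrix.isUnits_det_units _
  exact mem_integralUpToScalars_of_eq_map _ hdet hmat

/-- For fixed `n`, the points `k · diag(pⁿ,1)⁻¹ · ℚ_pˣGL₂(ℤ_p)` (`k ∈ GL₂(ℤ_p)`) are finitely many
(at most `#M₂(ℤ/pⁿ)`). [folklore] -/
theorem finite_range_coe_mul_diag_inv (n : ℕ) :
    (Set.range fun k : GL (Fin 2) ℤ_[p] ↦
      ((Matrix.GeneralLinearGroup.map PadicInt.Coe.ringHom k * (Matrix.GeneralLinearGroup.mkOfDetNeZero (!![(p : ℚ_[p]) ^ n, 0; 0, 1])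
        (by rw [det_diagPow]; exact p_pow_ne_zero n))⁻¹ : GL (Fin 2) ℚ_[p]) : GL (Fin 2) ℚ_[p] ⧸ integralUpToScalars (PadicInt.Coe.ringHom (p := p)))).Finite := by
  haveI : NeZero (p ^ n) := ⟨pow_ne_zero _ (Fact.out : p.Prime).ne_zero⟩
  exact finite_range_of_factorsThrough _
    (fun k : GL (Fin 2) ℤ_[p] ↦ (k : Matrix (Fin 2) (Fin 2) ℤ_[p]).map (PadicInt.toZModPow n))
    (fun k k' h ↦ coe_mul_diag_inv_eq_of_congr h)

/-! ## The exponent `n` is bounded in terms of `Δ(f)` -/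

/-- If `diag(pⁿ,1) · g` is integral for an integral `g`, then `pⁿ ∣ d(g)` and `p²ⁿ ∣ e(g)`, hence
`p²ⁿ ∣ Δ(g)`. [cite: BhargavaShankarAnnals2015, Prop. 3.18, proof, first paragraph (published numbering)] -/
theorem pow_dvd_disc_of_diag_smul_integral {n : ℕ} (g h₀ : BinaryQuartic ℤ_[p])
    (h : twist (!![(p : ℚ_[p]) ^ n, 0; 0, 1]) (g.map PadicInt.Coe.ringHom) = h₀.map PadicInt.Coe.ringHom) :
    ((p : ℤ_[p]) ^ n) ^ 2 ∣ g.disc := by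
  have hD : (!![(p : ℚ_[p]) ^ n, 0; 0, 1] : Matrix (Fin 2) (Fin 2) ℚ_[p]) =
      (!![(p : ℤ_[p]) ^ n, 0; 0, 1] : Matrix (Fin 2) (Fin 2) ℤ_[p]).map PadicInt.Coe.ringHom := by
    ext i j; fin_cases i <;> fin_cases j <;> simp
  -- `g.subst diag = p²ⁿ h₀`
  have hsub : g.subst !![(p : ℤ_[p]) ^ n, 0; 0, 1] = (((p : ℤ_[p]) ^ n) ^ 2) • h₀ := by
    apply map_coe_injective
    have h2 : (p : ℚ_[p]) ^ n ≠ 0 := p_pow_ne_zero n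
    rw [twist, det_diagPow, hD, ← map_subst] at h
    have h3 := congrArg (fun F ↦ (((p : ℚ_[p]) ^ n) ^ 2) • F) h
    simp only [smul_smul, mul_inv_cancel₀ (pow_ne_zero 2 h2), one_smul] at h3
    rw [h3]
    ext <;> simp [map]
  rw [subst_diagonal] at hsub
  have hd : (p : ℤ_[p]) ^ n ∣ g.d := by
    have := congrArg BinaryQuartic.d hsub
    simp only [one_pow, mul_one, smul_d] at this
    -- `g.d * pⁿ = p²ⁿ h₀.d`
    have h4 : g.d = (p : ℤ_[p]) ^ n * h₀.d := by
      have hpn : ((p : ℤ_[p]) ^ n) ≠ 0 := pow_ne_zero _ (by exact_mod_cast (Fact.out : p.Prime).ne_zero)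
      apply mul_right_cancel₀ hpn
      linear_combination this
    exact ⟨h₀.d, h4⟩
  have he : ((p : ℤ_[p]) ^ n) ^ 2 ∣ g.e := by
    have := congrArg BinaryQuartic.e hsub
    simp only [one_pow, mul_one, smul_e] at this
    exact ⟨h₀.e, this⟩
  exact sq_dvd_disc_of_dvd_d_of_sq_dvd_e g hd he

/-- Norm form: under the same hypothesis, `|Δ(g)|_p ≤ p⁻²ⁿ`. [folklore] -/
theorem norm_disc_le_of_diag_smul_integral {n : ℕ} (g h₀ : BinaryQuartic ℤ_[p])
    (h : twist (!![(p : ℚ_[p]) ^ n, 0; 0, 1]) (g.map PadicInt.Coe.ringHom) = h₀.map PadicInt.Coe.ringHom) :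
    ‖g.disc‖ ≤ ((p : ℝ) ^ n)⁻¹ ^ 2 := by
  obtain ⟨w, hw⟩ := pow_dvd_disc_of_diag_smul_integral g h₀ h
  rw [hw, norm_mul, norm_pow, PadicInt.norm_p_pow, _root_.zpow_neg, zpow_natCast]
  exact mul_le_of_le_one_right (by positivity) (PadicInt.norm_le_one w)

/-- The bound on the exponent: if `|Δ(f)|_p ≤ p⁻²ⁿ` and `Δ(f) ≠ 0` then `n ≤ ⌊1/|Δ(f)|_p⌋`. [folklore] -/
theorem le_floor_of_norm_le {n : ℕ} {x : ℤ_[p]} (hx : x ≠ 0) (h : ‖x‖ ≤ ((p : ℝ) ^ n)⁻¹ ^ 2) :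
    n ≤ ⌊‖x‖⁻¹⌋₊ := by
  have hp : (2 : ℝ) ≤ p := by exact_mod_cast (Fact.out : p.Prime).two_le
  have hxpos : 0 < ‖x‖ := norm_pos_iff.mpr hx
  have hpn : (1 : ℝ) ≤ (p : ℝ) ^ n := one_le_pow₀ (by linarith)
  -- `‖x‖ ≤ p⁻²ⁿ ≤ p⁻ⁿ`, so `pⁿ ≤ 1/‖x‖` and `n ≤ 2ⁿ ≤ pⁿ`
  have h1 : ‖x‖ ≤ ((p : ℝ) ^ n)⁻¹ := by
    refine h.trans ?_
    rw [sq]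
    exact mul_le_of_le_one_right (by positivity) (inv_le_one_of_one_le₀ hpn)
  have h2 : (p : ℝ) ^ n ≤ ‖x‖⁻¹ := by
    rw [le_inv_comm₀ (by positivity) hxpos]; exact h1
  have h3 : (n : ℝ) ≤ (p : ℝ) ^ n := by
    have : (n : ℝ) < (2 : ℝ) ^ n := by exact_mod_cast Nat.lt_two_pow_self
    exact this.le.trans (pow_le_pow_left₀ (by norm_num) hp n)
  exact Nat.le_floor (h3.trans h2)

/-! ## Finiteness of the cosets -/

/-- **Every coset `PGL₂(ℤ_p)g` with `g · f ∈ V_{ℤ_p}` is the coset of `(k · diag(pⁿ,1)⁻¹)⁻¹` with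
`k ∈ GL₂(ℤ_p)` and `p⁻²ⁿ ≥ |Δ(f)|_p`** (Cartan decomposition). [folklore] -/
theorem exists_rep_of_mem_cosets (f : BinaryQuartic ℤ_[p]) {q : GL (Fin 2) ℚ_[p] ⧸ integralUpToScalars (PadicInt.Coe.ringHom (p := p))}
    (hq : q ∈ cosets (PadicInt.Coe.ringHom (p := p)) (f.map PadicInt.Coe.ringHom)) :
    ∃ (n : ℕ) (k : GL (Fin 2) ℤ_[p]), ‖f.disc‖ ≤ ((p : ℝ) ^ n)⁻¹ ^ 2 ∧
      q = ((Matrix.GeneralLinearGroup.map PadicInt.Coe.ringHom k * (Matrix.GeneralLinearGroup.mkOfDetNeZero (!![(p : ℚ_[p]) ^ n, 0; 0, 1])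
        (by rw [det_diagPow]; exact p_pow_ne_zero n))⁻¹ : GL (Fin 2) ℚ_[p]) : GL (Fin 2) ℚ_[p] ⧸ integralUpToScalars (PadicInt.Coe.ringHom (p := p))) := by
  induction q using QuotientGroup.induction_on with
  | H h =>
  rw [coe_mem_cosets_iff] at hq
  obtain ⟨c, n, k₁, k₁', k₂, k₂', hc, hk₁, hk₂, hγ⟩ := exists_cartan_decomposition (det_coe_ne_zero h⁻¹)
  -- the units
  let u₁ : GL (Fin 2) ℤ_[p] := ⟨k₁, k₁', mul_eq_one_comm.mp hk₁, hk₁⟩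
  let u₂ : GL (Fin 2) ℤ_[p] := ⟨k₂, k₂', hk₂, mul_eq_one_comm.mp hk₂⟩
  set d : GL (Fin 2) ℚ_[p] := Matrix.GeneralLinearGroup.mkOfDetNeZero (!![(p : ℚ_[p]) ^ n, 0; 0, 1])
    (by rw [det_diagPow]; exact p_pow_ne_zero n) with hd
  let z : GL (Fin 2) ℚ_[p] := Matrix.GeneralLinearGroup.scalar (Fin 2) (Units.mk0 c hc)
  have hz : z ∈ integralUpToScalars (PadicInt.Coe.ringHom (p := p)) := scalar_mem hc
  -- `h⁻¹ = z u₁ d u₂`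
  have hinv : h⁻¹ = z * Matrix.GeneralLinearGroup.map PadicInt.Coe.ringHom u₁ * d * Matrix.GeneralLinearGroup.map PadicInt.Coe.ringHom u₂ := by
    apply Units.ext
    rw [hγ]
    simp only [Units.val_mul, coe_mapGL, hd, coe_diagGL, z, Matrix.GeneralLinearGroup.coe_scalar,
      Units.val_mk0, Matrix.scalar_apply]
    rw [Matrix.smul_eq_diagonal_mul]
    simp only [Matrix.mul_assoc, u₁, u₂]
  have hh : h = (Matrix.GeneralLinearGroup.map PadicInt.Coe.ringHom u₂)⁻¹ * d⁻¹ * ((Matrix.GeneralLinearGroup.map PadicInt.Coe.ringHom u₁)⁻¹ * z⁻¹) := by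
    rw [← inv_inv h, hinv]; group
  refine ⟨n, u₂⁻¹, ?_, ?_⟩
  · -- the bound: `d • (u₂ • f)` is integral
    have hint : d • (Matrix.GeneralLinearGroup.map PadicInt.Coe.ringHom u₂ • f.map PadicInt.Coe.ringHom) ∈ integralForms (PadicInt.Coe.ringHom (p := p)) := by
      have : d • (Matrix.GeneralLinearGroup.map PadicInt.Coe.ringHom u₂ • f.map PadicInt.Coe.ringHom) = (z * Matrix.GeneralLinearGroup.map PadicInt.Coe.ringHom u₁)⁻¹ • (h⁻¹ • f.map PadicInt.Coe.ringHom) := by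
        rw [hinv]
        simp only [← mul_smul]
        congr 1; group
      rw [this]
      exact smul_mem_integralForms _ ((integralUpToScalars _).inv_mem
        ((integralUpToScalars _).mul_mem hz (mapGL_mem u₁))) hq
    -- `u₂ • f = g` integral with the same `|Δ|`
    have hdet2 : k₂.det * k₂'.det = 1 := by rw [← Matrix.det_mul, hk₂, Matrix.det_one]
    have hg : Matrix.GeneralLinearGroup.map PadicInt.Coe.ringHom u₂ • f.map PadicInt.Coe.ringHom = ((k₂'.det ^ 2) • f.subst k₂).map PadicInt.Coe.ringHom := by
      rw [gl_smul_def, coe_mapGL]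
      exact twist_map_map_eq _ hdet2 f
    set g : BinaryQuartic ℤ_[p] := (k₂'.det ^ 2) • f.subst k₂ with hgdef
    obtain ⟨h₀, hh₀⟩ := hint
    rw [hg, gl_smul_def, hd, coe_diagGL] at hh₀
    have hbound := norm_disc_le_of_diag_smul_integral g h₀ hh₀.symm
    -- `‖Δ g‖ = ‖Δ f‖`
    have hnorm : ‖g.disc‖ = ‖f.disc‖ := by
      have h3 : (3 : ℚ_[p]) ≠ 0 := by norm_num
      have hK : (k₂.map PadicInt.Coe.ringHom).det ≠ 0 := by
        rw [← coe_mapGL u₂]; exact det_coe_ne_zero _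
      have := disc_twist h3 hK (f.map PadicInt.Coe.ringHom)
      rw [← coe_mapGL u₂, ← gl_smul_def, hg, disc_map, disc_map] at this
      rw [← PadicInt.padic_norm_e_of_padicInt, ← PadicInt.padic_norm_e_of_padicInt]
      exact congrArg _ this
    rw [← hnorm]; exact hbound
  · rw [hh, map_inv]
    exact QuotientGroup.mk_mul_of_mem _ ((integralUpToScalars _).mul_mem
      ((integralUpToScalars _).inv_mem (mapGL_mem u₁)) ((integralUpToScalars _).inv_mem hz))

/-- **Finiteness of `m_p`: for `f ∈ V_{ℤ_p}` with `Δ(f) ≠ 0`, the cosets `PGL₂(ℤ_p)g`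
(`g ∈ PGL₂(ℚ_p)`) with `g · f ∈ V_{ℤ_p}` are finitely many.** [cite: BhargavaShankarAnnals2015, §3.2 (m_p(f); published numbering)] -/
theorem cosets_padic_finite (f : BinaryQuartic ℤ_[p]) (hΔ : f.disc ≠ 0) : (cosets (PadicInt.Coe.ringHom (p := p)) (f.map PadicInt.Coe.ringHom)).Finite := by
  set N := ⌊‖f.disc‖⁻¹⌋₊
  refine (Set.Finite.biUnion (Set.finite_Iic N) fun n _ ↦ finite_range_coe_mul_diag_inv (p := p) n).subset ?_
  intro q hq
  obtain ⟨n, k, hn, rfl⟩ := exists_rep_of_mem_cosets f hq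
  exact Set.mem_biUnion (Set.mem_Iic.mpr (le_floor_of_norm_le hΔ hn)) ⟨k, rfl⟩

/-- Hence `m_p(f) = #{cosets PGL₂(ℤ_p)g : g · f ∈ V_{ℤ_p}}` for `Δ(f) ≠ 0`.
[cite: BhargavaShankarAnnals2015, §3.2 and proof of Prop. 3.6 (published numbering)] -/
theorem localWeight_eq_ncard_cosets (f : BinaryQuartic ℤ_[p]) (hΔ : f.disc ≠ 0) :
    localWeight f = (cosets (PadicInt.Coe.ringHom (p := p)) (f.map PadicInt.Coe.ringHom)).ncard :=
  weight_eq_ncard_cosets _ _ (cosets_padic_finite f hΔ)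

/-- `m_p(f) ≥ 1` for `Δ(f) ≠ 0`. [folklore] -/
theorem one_le_localWeight_of_disc_ne_zero (f : BinaryQuartic ℤ_[p]) (hΔ : f.disc ≠ 0) : 1 ≤ localWeight f :=
  one_le_localWeight f (cosets_padic_finite f hΔ)

/-! ## `m_p(f) = 1` for `p² ∤ Δ(f)`, `p ≥ 5` -/

/-- **For `p ≥ 5` and `p² ∤ Δ(f)`: the only coset is the trivial one and `m_p(f) = 1`** (every
`g ∈ GL₂(ℚ_p)` with `g · f` integral lies in `ℚ_pˣ·GL₂(ℤ_p)`, Prop. 3.18 of the published version).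
[cite: BhargavaShankarAnnals2015, Prop. 3.18 (published numbering)] -/
theorem localWeight_eq_one_of_not_sq_dvd_disc (hp : 5 ≤ p) (f : BinaryQuartic ℤ_[p])
    (hΔ : ¬ (p : ℤ_[p]) ^ 2 ∣ f.disc) :
    cosets (PadicInt.Coe.ringHom (p := p)) (f.map PadicInt.Coe.ringHom) = {((1 : GL (Fin 2) ℚ_[p]) : GL (Fin 2) ℚ_[p] ⧸ integralUpToScalars (PadicInt.Coe.ringHom (p := p)))} ∧ localWeight f = 1 := by
  refine weight_eq_one_of_forall_mem _ (map_mem_integralForms _ f) fun g hg ↦ ?_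
  obtain ⟨f', hf'⟩ := hg
  obtain ⟨c, k, hc, hk, hgk⟩ := (good_at_of_not_sq_dvd_disc hp f hΔ).2.1 (g : Matrix (Fin 2) (Fin 2) ℚ_[p]) f'
    (det_coe_ne_zero g) (by rw [← gl_smul_def]; exact hf'.symm)
  exact ⟨c, k, hc, hk, hgk⟩

/-- For `f ∈ V_ℤ`, a prime `p ≥ 5` with `p² ∤ Δ(f)` has `m_p(f) = 1`. [cite: BhargavaShankarAnnals2015, Prop. 3.18 (published numbering)] -/
theorem localWeightAt_eq_one_of_not_sq_dvd_disc {p : ℕ} (hpp : p.Prime) (hp : 5 ≤ p) (f : BinaryQuartic ℤ)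
    (hΔ : ¬ (p : ℤ) ^ 2 ∣ f.disc) : localWeightAt p f = 1 := by
  haveI : Fact p.Prime := ⟨hpp⟩
  rw [localWeightAt_of_prime]
  refine (localWeight_eq_one_of_not_sq_dvd_disc hp _ fun h ↦ hΔ ?_).2
  exact sq_dvd_disc_int_of_padicInt h

/-- **`m_p(f) = 1` for all but finitely many `p`** (`f ∈ V_ℤ`, `Δ(f) ≠ 0`): the exceptional primes
are among `2`, `3` and the `p` with `p² ∣ Δ(f)`. [cite: BhargavaShankarAnnals2015, §3.2 and Prop. 3.18 (published numbering)] -/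
theorem finite_setOf_localWeightAt_ne_one (f : BinaryQuartic ℤ) (hΔ : f.disc ≠ 0) :
    {p : ℕ | localWeightAt p f ≠ 1}.Finite := by
  refine (Set.finite_Iic (max 4 f.disc.natAbs)).subset fun p hp ↦ ?_
  simp only [Set.mem_setOf_eq] at hp
  rw [Set.mem_Iic]
  by_contra hlt
  push Not at hlt
  have h5 : 5 ≤ p := by omega
  have hpp : p.Prime := by
    by_contra hnp
    exact hp (localWeightAt_of_not_prime hnp f)
  apply hp (localWeightAt_eq_one_of_not_sq_dvd_disc hpp h5 f ?_)
  intro hdvd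
  have h1 : (p : ℤ) ∣ f.disc := (dvd_pow_self (p : ℤ) two_ne_zero).trans hdvd
  have h2 : p ∣ f.disc.natAbs := Int.natCast_dvd.mp h1
  have h3 : p ≤ f.disc.natAbs := Nat.le_of_dvd (Int.natAbs_pos.mpr hΔ) h2
  omega

/-- The local cosets of an integral form `f ∈ V_ℤ` with `Δ(f) ≠ 0` are finitely many at every prime.
[folklore] -/
theorem cosets_padic_finite_int (f : BinaryQuartic ℤ) (hΔ : f.disc ≠ 0) :
    (cosets (PadicInt.Coe.ringHom (p := p)) ((f.map (Int.castRingHom ℤ_[p])).map PadicInt.Coe.ringHom)).Finite :=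
  cosets_padic_finite _ (by
    rw [disc_map]; exact (map_ne_zero_iff (Int.castRingHom ℤ_[p]) Int.cast_injective).mpr hΔ)

end BinaryQuartic

end Literature.NumberTheory.EllipticCurves

end
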